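import Summits.BirchSwinnertonDyer.BirchSwinnertonDyer.Theorems.GenusKolyvaginAtTwoTorsionCellSELBorderedAlgebra
import HarnessLib

/-!
# SEL (iso-class Selmer pair law), C1-L: the raw rows in the symbols of `Q` ⟺ the unified matrix system `SysC1`

Crux R″ `RankOneTwoTorsionResidualAtTwo` (stmt-27478), LINE 49 «full_vertex», SUPPORT stub SEL
`IsoClassSelmerPairLawAtTwo`, the `C₁` half (LEAD memo `Cruxes/…/Lines/torsion_cell_full_vertex_SEL_C1_road_g36.md`, §3).
Pure bookkeeping between the two presentations of the same `𝔽₂`-linear system: the RAW ROWS of parts C1-F/C1-J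
(inline sums over `Q ∖ j`, supports `A₁, A₂ ⊆ Q`, constants `c₁ = τ₁+ετ₂`, `c₂ = (1+ε)τ₁+τ₂`, `ρ₁ = s₁ = σ`,
`ρ₂ = s₂ = τ₁+τ₂`) and the MATRIX SYSTEM of parts C1-C/C1-D (`borderedLaplacian Q p₀ *ᵥ χ`, indicator vectors
`χ₁, χ₂ : Q → 𝔽₂` of `A₁, A₂`): **`sysC1_iff_rawRows`**.  The bridge is `(Bχ) j = Σ_{i≠j}[−i/j]χ i + (g_j + π_j)χ j`
(`mulVec_redeiLaplacian_apply_eq_sum_erase` plus the diagonal border).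

Everything is proved; no LINE 49 statement is restated; BSD is not advanced by this file alone.

## References

* [HeathBrown1994SelmerCongruentII] D. R. Heath-Brown, Invent. Math. 118 (1994), §2.
* [Kane2013SelmerTwists] D. M. Kane, Algebra Number Theory 7 (2013), §2.
-/

namespace Summit.BirchSwinnertonDyer.BirchSwinnertonDyer.Theorems.GenusKolyvaginAtTwo.FullVertex

open Matrix
open Summit.BirchSwinnertonDyer.BirchSwinnertonDyer.Theorems.GenusKolyvaginAtTwo.TorsionCellSEL

variable (Q : Finset ℕ) (p₀ : ℕ)

/-- `(Bχ) j` in inline form for an indicator vector: `Σ_{i∈Q∖j}[−i/j]𝟙_A(i) + (g_j + π_j)𝟙_A(j)`.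
[cite: HeathBrown1994SelmerCongruentII, §2] -/
theorem mulVec_borderedLaplacian_indicator (A : Finset ℕ) (j : Q) :
    (borderedLaplacian Q p₀ *ᵥ fun i : Q => if (i : ℕ) ∈ A then (1 : ZMod 2) else 0) j =
      (∑ i ∈ Q.erase j, (if jacobiSym (-(i : ℤ)) j = -1 then (1 : ZMod 2) else 0) * (if i ∈ A then 1 else 0)) +
        ((∑ i ∈ Q.erase j, (if jacobiSym (-(i : ℤ)) j = -1 then (1 : ZMod 2) else 0)) +
          legendreBit (-(p₀ : ℤ)) (j : ℕ)) * (if (j : ℕ) ∈ A then 1 else 0) := by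
  unfold borderedLaplacian
  rw [add_mulVec, Pi.add_apply, mulVec_diagonal,
    mulVec_redeiLaplacian_apply_eq_sum_erase Q (fun n : ℕ => if n ∈ A then (1 : ZMod 2) else 0) j]
  ring

/-- `Σ_{i : Q} 𝟙_A(i) = #A` for `A ⊆ Q`. [folklore] -/
theorem sum_indicator_eq_card {A : Finset ℕ} (hA : A ⊆ Q) :
    ∑ i : Q, (if (i : ℕ) ∈ A then (1 : ZMod 2) else 0) = (A.card : ZMod 2) := by
  rw [Finset.sum_coe_sort Q (fun i => if i ∈ A then (1 : ZMod 2) else 0), ← Finset.sum_filter,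
    Finset.filter_mem_eq_inter, Finset.inter_eq_right.mpr hA, Finset.sum_const, nsmul_eq_mul, mul_one]

/-- `Σ_{i : Q} F i 𝟙_A(i) = Σ_{i ∈ Q} F i 𝟙_A(i)`. [folklore] -/
theorem sum_mul_indicator_eq (F : ℕ → ZMod 2) (A : Finset ℕ) :
    ∑ i : Q, F i * (if (i : ℕ) ∈ A then (1 : ZMod 2) else 0) = ∑ i ∈ Q, F i * (if i ∈ A then 1 else 0) :=
  Finset.sum_coe_sort Q (fun i => F i * (if i ∈ A then (1 : ZMod 2) else 0))

/-- **RAW ROWS ⟺ MATRIX SYSTEM** for indicator vectors `χ₁ = 𝟙_{A₁}`, `χ₂ = 𝟙_{A₂}` and the standard constants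
`c₁ = τ₁+ετ₂`, `c₂ = (1+ε)τ₁+τ₂`, `ρ₁ = s₁ = σ`, `ρ₂ = s₂ = τ₁+τ₂`.
[cite: HeathBrown1994SelmerCongruentII, §2] [cite: Kane2013SelmerTwists, §2] -/
theorem sysC1_iff_rawRows (ε σ τ₁ τ₂ γ₁ γ₂ : ZMod 2) {A₁ A₂ : Finset ℕ} (hA₁ : A₁ ⊆ Q) (hA₂ : A₂ ⊆ Q) :
    ((∀ j : Q, (borderedLaplacian Q p₀ *ᵥ (fun i : Q => if (i : ℕ) ∈ A₁ then (1 : ZMod 2) else 0)) j +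
          ε * (if (j : ℕ) ∈ A₁ then (1 : ZMod 2) else 0) + (if (j : ℕ) ∈ A₂ then (1 : ZMod 2) else 0) =
        γ₁ * legendreBit (-(p₀ : ℤ)) (j : ℕ) + (τ₁ + ε * τ₂ + ∑ i : Q, (if (i : ℕ) ∈ A₁ then (1 : ZMod 2) else 0))) ∧
      (∀ j : Q, (borderedLaplacian Q p₀ *ᵥ (fun i : Q => if (i : ℕ) ∈ A₂ then (1 : ZMod 2) else 0)) j +
          (ε + 1) * (if (j : ℕ) ∈ A₂ then (1 : ZMod 2) else 0) + (if (j : ℕ) ∈ A₁ then (1 : ZMod 2) else 0) =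
        γ₂ * legendreBit (-(p₀ : ℤ)) (j : ℕ) + ((ε + 1) * τ₁ + τ₂ + ∑ i : Q, (if (i : ℕ) ∈ A₂ then (1 : ZMod 2) else 0))) ∧
      (∑ j : Q, legendreBit (-(p₀ : ℤ)) (j : ℕ) * (if (j : ℕ) ∈ A₁ then (1 : ZMod 2) else 0) +
          (∑ j : Q, legendreBit (-(p₀ : ℤ)) (j : ℕ)) * γ₁ = σ) ∧
      (∑ j : Q, legendreBit (-(p₀ : ℤ)) (j : ℕ) * (if (j : ℕ) ∈ A₂ then (1 : ZMod 2) else 0) +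
          (∑ j : Q, legendreBit (-(p₀ : ℤ)) (j : ℕ)) * γ₂ + γ₂ + γ₁ + τ₁ + τ₂ = 0) ∧
      (γ₁ + γ₂ + τ₁ + τ₂ = σ)) ↔
    ((∀ j ∈ Q,
        ((∑ i ∈ Q.erase j, (if jacobiSym (-(i : ℤ)) j = -1 then (1 : ZMod 2) else 0) * (if i ∈ A₁ then 1 else 0)) +
            ((∑ i ∈ Q.erase j, (if jacobiSym (-(i : ℤ)) j = -1 then (1 : ZMod 2) else 0)) +
              (if jacobiSym (-(p₀ : ℤ)) j = -1 then (1 : ZMod 2) else 0) + ε) * (if j ∈ A₁ then 1 else 0) +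
            (if j ∈ A₂ then 1 else 0) =
          (τ₁ + ε * τ₂) + γ₁ * (if jacobiSym (-(p₀ : ℤ)) j = -1 then (1 : ZMod 2) else 0) + (A₁.card : ZMod 2)) ∧
        ((∑ i ∈ Q.erase j, (if jacobiSym (-(i : ℤ)) j = -1 then (1 : ZMod 2) else 0) * (if i ∈ A₂ then 1 else 0)) +
            ((∑ i ∈ Q.erase j, (if jacobiSym (-(i : ℤ)) j = -1 then (1 : ZMod 2) else 0)) +
              (if jacobiSym (-(p₀ : ℤ)) j = -1 then (1 : ZMod 2) else 0) + ε + 1) * (if j ∈ A₂ then 1 else 0) +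
            (if j ∈ A₁ then 1 else 0) =
          ((1 + ε) * τ₁ + τ₂) + γ₂ * (if jacobiSym (-(p₀ : ℤ)) j = -1 then (1 : ZMod 2) else 0) + (A₂.card : ZMod 2))) ∧
      (σ + ∑ i ∈ Q, (if jacobiSym (-(p₀ : ℤ)) i = -1 then (1 : ZMod 2) else 0) * (if i ∈ A₁ then 1 else 0) +
          γ₁ * ∑ i ∈ Q, (if jacobiSym (-(p₀ : ℤ)) i = -1 then (1 : ZMod 2) else 0) = 0) ∧
      ((τ₁ + τ₂) + γ₂ + ∑ i ∈ Q, (if jacobiSym (-(p₀ : ℤ)) i = -1 then (1 : ZMod 2) else 0) * (if i ∈ A₂ then 1 else 0) +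
          γ₁ + γ₂ * ∑ i ∈ Q, (if jacobiSym (-(p₀ : ℤ)) i = -1 then (1 : ZMod 2) else 0) = 0) ∧
      (σ + γ₁ = (τ₁ + τ₂) + γ₂)) := by
  -- conversions
  have hB₁ := mulVec_borderedLaplacian_indicator Q p₀ A₁
  have hB₂ := mulVec_borderedLaplacian_indicator Q p₀ A₂
  have hc₁ := sum_indicator_eq_card Q hA₁
  have hc₂ := sum_indicator_eq_card Q hA₂
  have hπ₁ : ∑ j : Q, legendreBit (-(p₀ : ℤ)) (j : ℕ) * (if (j : ℕ) ∈ A₁ then (1 : ZMod 2) else 0) =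
      ∑ i ∈ Q, (if jacobiSym (-(p₀ : ℤ)) i = -1 then (1 : ZMod 2) else 0) * (if i ∈ A₁ then 1 else 0) :=
    sum_mul_indicator_eq Q (fun i => legendreBit (-(p₀ : ℤ)) i) A₁
  have hπ₂ : ∑ j : Q, legendreBit (-(p₀ : ℤ)) (j : ℕ) * (if (j : ℕ) ∈ A₂ then (1 : ZMod 2) else 0) =
      ∑ i ∈ Q, (if jacobiSym (-(p₀ : ℤ)) i = -1 then (1 : ZMod 2) else 0) * (if i ∈ A₂ then 1 else 0) :=
    sum_mul_indicator_eq Q (fun i => legendreBit (-(p₀ : ℤ)) i) A₂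
  have hπ : ∑ j : Q, legendreBit (-(p₀ : ℤ)) (j : ℕ) = ∑ i ∈ Q, (if jacobiSym (-(p₀ : ℤ)) i = -1 then (1 : ZMod 2) else 0) :=
    Finset.sum_coe_sort Q (fun i => legendreBit (-(p₀ : ℤ)) i)
  simp only [hc₁, hc₂, hπ₁, hπ₂, hπ]
  constructor
  · rintro ⟨hQa, hQb, hPa, hPb, hinf⟩
    refine ⟨fun j hj => ⟨?_, ?_⟩, ?_, ?_, ?_⟩
    · have e := hQa ⟨j, hj⟩
      rw [hB₁] at e
      simp only [legendreBit_eq_ite] at e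
      linear_combination e
    · have e := hQb ⟨j, hj⟩
      rw [hB₂] at e
      simp only [legendreBit_eq_ite] at e
      linear_combination e
    · linear_combination (norm := (ring_nf; reduce_mod_char)) hPa
    · linear_combination hPb
    · linear_combination (norm := (ring_nf; reduce_mod_char)) hinf
  · rintro ⟨hrows, hPa, hPb, hinf⟩
    refine ⟨fun j => ?_, fun j => ?_, ?_, ?_, ?_⟩
    · have e := (hrows j j.2).1
      rw [hB₁]
      simp only [legendreBit_eq_ite]
      linear_combination e
    · have e := (hrows j j.2).2
      rw [hB₂]
      simp only [legendreBit_eq_ite]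
      linear_combination e
    · linear_combination (norm := (ring_nf; reduce_mod_char)) hPa
    · linear_combination hPb
    · linear_combination (norm := (ring_nf; reduce_mod_char)) hinf

end Summit.BirchSwinnertonDyer.BirchSwinnertonDyer.Theorems.GenusKolyvaginAtTwo.FullVertex
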